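import Summits.CriticalPhenomena.SAWScalingLimit.Theses.SAWPhaseRetrieval
import Summits.CriticalPhenomena.SAWScalingLimit.Theorems.SAWPhaseRetrievalRetrievalStabilityDiscAlgebra
import Literature.Probability.LatticeModels.TriangularLatticeProofs
import Literature.Barriers.CriticalPhenomena.ParafermionicHalfCauchyRiemann

/-!
# Retrieval stability, disc case — the rhombus tile, II: signed areas

For the proof of `SAWPhaseRetrieval.RetrievalStabilityDisc` (stmt-CriticalPhenomena-11413).
The discrete Green (shoelace) identity on the `ρ × ρ` grid of cells of the tile: the sum over the
cells of (twice) the signed areas of the two image triangles of a cell equals the shoelace sum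
over the boundary polygon.  Each image triangle is near-equilateral with the orientation of the
lattice triangle, so its signed area is at least `κ(ε) λ²` (`λ` = the value `‖G‖` on its horizontal
edge, `κ = (1-7ε)²(√3/2 - 3ε)`); this bounds `Σ λ²` over the `2ρ²` triangles of the tile by the
boundary shoelace sum.  (The boundary sum is estimated in part III.)
-/

namespace Summit.CriticalPhenomena.SAWScalingLimit.Theorems

open Literature.Probability.LatticeModels Literature.Probability.Percolation Complex Finset

local notation "EA[" a "," b "]" =>
  (s(((![a, b] : Site 2), (0 : Fin 2)), ((![a, b] : Site 2), (1 : Fin 2))) : Sym2 HexVertex)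
local notation "EB[" a "," b "]" =>
  (s(((![a, b] : Site 2), (0 : Fin 2)), ((![a - 1, b] : Site 2), (1 : Fin 2))) : Sym2 HexVertex)
local notation "EC[" a "," b "]" =>
  (s(((![a, b] : Site 2), (0 : Fin 2)), ((![a, b - 1] : Site 2), (1 : Fin 2))) : Sym2 HexVertex)

/-! ### The shoelace identity on a grid -/

/-- `Im (conj y · x) = - Im (conj x · y)`. [folklore] -/
theorem rsd_im_conj_mul_swap (x y : ℂ) :
    ((starRingEnd ℂ) y * x).im = -((starRingEnd ℂ) x * y).im := by
  simp only [mul_im, conj_re, conj_im]; ring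

/-- **Discrete Green identity on the `n × n` grid.** For any `W : ℕ → ℕ → ℂ`, the sum over the
cells of the shoelace terms of the cell boundary (counter-clockwise) equals the shoelace sum of
the outer boundary: interior edges cancel. [folklore] -/
theorem rsd_shoelace_grid (W : ℕ → ℕ → ℂ) (n : ℕ) :
    ∑ s ∈ range n, ∑ t ∈ range n,
      (((starRingEnd ℂ) (W s t) * W (s + 1) t).im +
        ((starRingEnd ℂ) (W (s + 1) t) * W (s + 1) (t + 1)).im +
        ((starRingEnd ℂ) (W (s + 1) (t + 1)) * W s (t + 1)).im +
        ((starRingEnd ℂ) (W s (t + 1)) * W s t).im) =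
    (∑ s ∈ range n, ((starRingEnd ℂ) (W s 0) * W (s + 1) 0).im) +
      (∑ t ∈ range n, ((starRingEnd ℂ) (W n t) * W n (t + 1)).im) +
      (∑ s ∈ range n, ((starRingEnd ℂ) (W (s + 1) n) * W s n).im) +
      (∑ t ∈ range n, ((starRingEnd ℂ) (W 0 (t + 1)) * W 0 t).im) := by
  -- bottom/top terms telescope in `t`, right/left terms telescope in `s`
  set B : ℕ → ℕ → ℝ := fun s t => ((starRingEnd ℂ) (W s t) * W (s + 1) t).im with hB
  set R : ℕ → ℕ → ℝ := fun s t => ((starRingEnd ℂ) (W s t) * W s (t + 1)).im with hR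
  have h1 : ∀ s t, ((starRingEnd ℂ) (W (s + 1) (t + 1)) * W s (t + 1)).im = -B s (t + 1) := by
    intro s t; simp only [hB]; exact rsd_im_conj_mul_swap _ _
  have h2 : ∀ s t, ((starRingEnd ℂ) (W s (t + 1)) * W s t).im = -R s t := by
    intro s t; simp only [hR]; exact rsd_im_conj_mul_swap _ _
  have h3 : ∀ s t, ((starRingEnd ℂ) (W (s + 1) t) * W (s + 1) (t + 1)).im = R (s + 1) t := by
    intro s t; simp only [hR]
  have h4 : ∀ s t, ((starRingEnd ℂ) (W s t) * W (s + 1) t).im = B s t := by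
    intro s t; simp only [hB]
  have h5 : ∀ s, ((starRingEnd ℂ) (W (s + 1) n) * W s n).im = -B s n := by
    intro s; simp only [hB]; exact rsd_im_conj_mul_swap _ _
  have h7 : ∀ t, ((starRingEnd ℂ) (W n t) * W n (t + 1)).im = R n t := by
    intro t; simp only [hR]
  simp only [h1, h2, h3, h4, h5, h7]
  have inner : ∀ s, ∑ t ∈ range n, (B s t + R (s + 1) t + -B s (t + 1) + -R s t) =
      (B s 0 - B s n) + ∑ t ∈ range n, (R (s + 1) t - R s t) := by
    intro s
    have split : ∀ t ∈ range n, B s t + R (s + 1) t + -B s (t + 1) + -R s t =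
        (B s t - B s (t + 1)) + (R (s + 1) t - R s t) := fun t _ => by ring
    rw [Finset.sum_congr rfl split, Finset.sum_add_distrib, Finset.sum_range_sub' (B s) n]
  rw [Finset.sum_congr rfl fun s _ => inner s, Finset.sum_add_distrib, Finset.sum_comm]
  have tr : ∀ t ∈ range n, ∑ s ∈ range n, (R (s + 1) t - R s t) = R n t - R 0 t := fun t _ =>
    Finset.sum_range_sub (fun s => R s t) n
  rw [Finset.sum_congr rfl tr, Finset.sum_sub_distrib, Finset.sum_sub_distrib, Finset.sum_neg_distrib,
    Finset.sum_neg_distrib]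
  ring

/-- Twice the signed areas of the two image triangles of a cell, `(P,Q,R)` and `(P,R,S)`, written
with differences, add up to the shoelace terms of the cell boundary `P → Q → R → S → P`.
[folklore] -/
theorem rsd_cell_shoelace (P Q R S : ℂ) :
    ((starRingEnd ℂ) (Q - P) * (R - P)).im + ((starRingEnd ℂ) (R - P) * (S - P)).im =
      ((starRingEnd ℂ) P * Q).im + ((starRingEnd ℂ) Q * R).im + ((starRingEnd ℂ) R * S).im +
        ((starRingEnd ℂ) S * P).im := by
  simp only [map_sub, mul_im, sub_re, sub_im, conj_re, conj_im]
  ring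

/-! ### Near-equilateral image triangles have signed area `≥ κ λ²` -/

/-- `conj ζ · (ζ - 1) = ζ`. [folklore] -/
theorem rsd_conj_triZeta_mul : (starRingEnd ℂ) triZeta * (triZeta - 1) = triZeta := by
  apply Complex.ext
  · simp only [mul_re, conj_re, conj_im, sub_re, sub_im, triZeta_re, triZeta_im, one_re, one_im]
    have h3 : Real.sqrt 3 * Real.sqrt 3 = 3 := Real.mul_self_sqrt (by norm_num)
    nlinarith [h3]
  · simp only [mul_im, conj_re, conj_im, sub_re, sub_im, triZeta_re, triZeta_im, one_re, one_im]
    ring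

/-- **Cell lower bound.** For a unit up triangle with closure `G_C + (ζ-1) G_A - ζ G_B = 0` and
phases within `ε ≤ 1/10` of `1`: twice the signed area of the image triangle, `Im (conj G_C · ζ G_B)`,
is at least `(1-7ε)² (√3/2 - 3ε) ‖G_C‖²`. [folklore] -/
theorem rsd_up_area_ge {GA GB GC : ℂ} {ε : ℝ} (hε : 0 ≤ ε) (hε1 : ε ≤ 1 / 10)
    (hrel : GC + (triZeta - 1) * GA - triZeta * GB = 0)
    (hA : ‖GA - ((‖GA‖ : ℝ) : ℂ)‖ ≤ ε * ‖GA‖) (hB : ‖GB - ((‖GB‖ : ℝ) : ℂ)‖ ≤ ε * ‖GB‖)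
    (hC : ‖GC - ((‖GC‖ : ℝ) : ℂ)‖ ≤ ε * ‖GC‖) :
    (1 - 7 * ε) ^ 2 * (Real.sqrt 3 / 2 - 3 * ε) * ‖GC‖ ^ 2 ≤
      ((starRingEnd ℂ) GC * (triZeta * GB)).im := by
  have T := rsd_three_reals hrel hC hA hB
  obtain ⟨_, hBC⟩ := rsd_three_reals_rel (norm_nonneg GC) (norm_nonneg GA) (norm_nonneg GB) hε hε1
    (rsd_three_reals_pairwise (norm_nonneg GC) (norm_nonneg GA) (norm_nonneg GB) hε T).1
    (rsd_three_reals_pairwise (norm_nonneg GC) (norm_nonneg GA) (norm_nonneg GB) hε T).2.2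
  have hlow := rsd_im_conj_mul_zeta_mul_ge (norm_nonneg GC) (norm_nonneg GB) hε (by linarith) hC hB
  have hb1 : (1 - 7 * ε) * ‖GC‖ ≤ ‖GB‖ := by have := (abs_le.1 hBC).1; linarith
  have hs : 0 ≤ Real.sqrt 3 / 2 - 3 * ε := by
    have : (1.7 : ℝ) ≤ Real.sqrt 3 := by
      rw [Real.le_sqrt (by norm_num) (by norm_num)]; norm_num
    linarith
  have h17 : 0 ≤ 1 - 7 * ε := by linarith
  calc (1 - 7 * ε) ^ 2 * (Real.sqrt 3 / 2 - 3 * ε) * ‖GC‖ ^ 2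
      ≤ (1 - 7 * ε) * (Real.sqrt 3 / 2 - 3 * ε) * ‖GC‖ ^ 2 := by
        apply mul_le_mul_of_nonneg_right _ (sq_nonneg _)
        apply mul_le_mul_of_nonneg_right _ hs
        nlinarith
    _ = ‖GC‖ * ((1 - 7 * ε) * ‖GC‖) * (Real.sqrt 3 / 2 - 3 * ε) := by ring
    _ ≤ ‖GC‖ * ‖GB‖ * (Real.sqrt 3 / 2 - 3 * ε) := by
        apply mul_le_mul_of_nonneg_right _ hs
        exact mul_le_mul_of_nonneg_left hb1 (norm_nonneg _)
    _ ≤ ((starRingEnd ℂ) GC * (triZeta * GB)).im := hlow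

/-- **Cell lower bound, down triangle.** With the down closure `G_C' + (ζ-1) G_A' - ζ G_B = 0`
(top edge `C'`, left edge `A'`, diagonal `B`): twice the signed area of the image of the down
triangle, `Im (conj (ζ G_B) · (ζ-1) G_A')`, is at least `(1-7ε)² (√3/2 - 3ε) ‖G_C'‖²`. [folklore] -/
theorem rsd_down_area_ge {GA GB GC : ℂ} {ε : ℝ} (hε : 0 ≤ ε) (hε1 : ε ≤ 1 / 10)
    (hrel : GC + (triZeta - 1) * GA - triZeta * GB = 0)
    (hA : ‖GA - ((‖GA‖ : ℝ) : ℂ)‖ ≤ ε * ‖GA‖) (hB : ‖GB - ((‖GB‖ : ℝ) : ℂ)‖ ≤ ε * ‖GB‖)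
    (hC : ‖GC - ((‖GC‖ : ℝ) : ℂ)‖ ≤ ε * ‖GC‖) :
    (1 - 7 * ε) ^ 2 * (Real.sqrt 3 / 2 - 3 * ε) * ‖GC‖ ^ 2 ≤
      ((starRingEnd ℂ) (triZeta * GB) * ((triZeta - 1) * GA)).im := by
  have e : (starRingEnd ℂ) (triZeta * GB) * ((triZeta - 1) * GA) =
      (starRingEnd ℂ) GB * (triZeta * GA) := by
    rw [map_mul]
    linear_combination ((starRingEnd ℂ) GB * GA) * rsd_conj_triZeta_mul
  rw [e]
  have T := rsd_three_reals hrel hC hA hB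
  obtain ⟨hAC, hBC⟩ := rsd_three_reals_rel (norm_nonneg GC) (norm_nonneg GA) (norm_nonneg GB) hε
    hε1 (rsd_three_reals_pairwise (norm_nonneg GC) (norm_nonneg GA) (norm_nonneg GB) hε T).1
    (rsd_three_reals_pairwise (norm_nonneg GC) (norm_nonneg GA) (norm_nonneg GB) hε T).2.2
  have hlow := rsd_im_conj_mul_zeta_mul_ge (norm_nonneg GB) (norm_nonneg GA) hε (by linarith) hB hA
  have ha1 : (1 - 7 * ε) * ‖GC‖ ≤ ‖GA‖ := by have := (abs_le.1 hAC).1; linarith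
  have hb1 : (1 - 7 * ε) * ‖GC‖ ≤ ‖GB‖ := by have := (abs_le.1 hBC).1; linarith
  have hs : 0 ≤ Real.sqrt 3 / 2 - 3 * ε := by
    have : (1.7 : ℝ) ≤ Real.sqrt 3 := by
      rw [Real.le_sqrt (by norm_num) (by norm_num)]; norm_num
    linarith
  have h17 : 0 ≤ (1 - 7 * ε) * ‖GC‖ := mul_nonneg (by linarith) (norm_nonneg _)
  calc (1 - 7 * ε) ^ 2 * (Real.sqrt 3 / 2 - 3 * ε) * ‖GC‖ ^ 2
      = ((1 - 7 * ε) * ‖GC‖) * ((1 - 7 * ε) * ‖GC‖) * (Real.sqrt 3 / 2 - 3 * ε) := by ring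
    _ ≤ ‖GB‖ * ‖GA‖ * (Real.sqrt 3 / 2 - 3 * ε) := by
        apply mul_le_mul_of_nonneg_right _ hs
        exact mul_le_mul hb1 ha1 h17 (norm_nonneg _)
    _ ≤ ((starRingEnd ℂ) GB * (triZeta * GA)).im := hlow

/-! ### Sum of squares over the tile is bounded by the boundary shoelace sum -/

/-- **Squares vs boundary.** Let `W' s t = p (a₀+s-t) (b₀+t) - p a₀ b₀` be the (normalised)
potential on the tile.  Then `κ(ε) Σ_{cells} (λ_up² + λ_down²)` is at most the shoelace sum of the
tile boundary, where `λ_up(s,t) = ‖G (C (a₀+s-t) (b₀+t))‖`, `λ_down(s,t) = ‖G (C (a₀+s-t-1) (b₀+t+1))‖`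
and `κ = (1-7ε)²(√3/2-3ε)`. [folklore] -/
theorem rsd_sumsq_le_boundary {G : Sym2 HexVertex → ℂ} {p : ℤ → ℤ → ℂ} {ε : ℝ} {a₀ b₀ : ℤ} {ρ : ℕ}
    (hH : ∀ a b : ℤ, b₀ ≤ b → b ≤ b₀ + ρ → a₀ + b₀ ≤ a + b → a + b < a₀ + b₀ + ρ →
      p (a + 1) b - p a b = G EC[a, b])
    (hV : ∀ a b : ℤ, b₀ ≤ b → b < b₀ + ρ → a₀ + b₀ ≤ a + b → a + b < a₀ + b₀ + ρ →
      p a (b + 1) - p a b = triZeta * G EB[a, b])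
    (hD : ∀ a b : ℤ, b₀ ≤ b → b < b₀ + ρ → a₀ + b₀ ≤ a + b + 1 → a + b + 1 ≤ a₀ + b₀ + ρ →
      p a (b + 1) - p (a + 1) b = (triZeta - 1) * G EA[a, b])
    (hPC : ∀ a b : ℤ, b₀ ≤ b → b ≤ b₀ + ρ → a₀ + b₀ ≤ a + b → a + b < a₀ + b₀ + ρ →
      ‖G EC[a, b] - ((‖G EC[a, b]‖ : ℝ) : ℂ)‖ ≤ ε * ‖G EC[a, b]‖)
    (hPB : ∀ a b : ℤ, b₀ ≤ b → b < b₀ + ρ → a₀ + b₀ ≤ a + b → a + b < a₀ + b₀ + ρ →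
      ‖G EB[a, b] - ((‖G EB[a, b]‖ : ℝ) : ℂ)‖ ≤ ε * ‖G EB[a, b]‖)
    (hPA : ∀ a b : ℤ, b₀ ≤ b → b < b₀ + ρ → a₀ + b₀ ≤ a + b + 1 → a + b + 1 ≤ a₀ + b₀ + ρ →
      ‖G EA[a, b] - ((‖G EA[a, b]‖ : ℝ) : ℂ)‖ ≤ ε * ‖G EA[a, b]‖)
    (hε : 0 ≤ ε) (hε1 : ε ≤ 1 / 10) :
    (1 - 7 * ε) ^ 2 * (Real.sqrt 3 / 2 - 3 * ε) *
      ∑ s ∈ range ρ, ∑ t ∈ range ρ,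
        (‖G EC[a₀ + s - t, b₀ + t]‖ ^ 2 + ‖G EC[a₀ + s - t - 1, b₀ + t + 1]‖ ^ 2) ≤
    (∑ s ∈ range ρ, ((starRingEnd ℂ) (p (a₀ + s - ((0 : ℕ) : ℤ)) (b₀ + ((0 : ℕ) : ℤ)) - p a₀ b₀) *
        (p (a₀ + ((s + 1 : ℕ) : ℤ) - ((0 : ℕ) : ℤ)) (b₀ + ((0 : ℕ) : ℤ)) - p a₀ b₀)).im) +
    (∑ t ∈ range ρ, ((starRingEnd ℂ) (p (a₀ + ρ - t) (b₀ + t) - p a₀ b₀) *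
        (p (a₀ + ρ - ((t + 1 : ℕ) : ℤ)) (b₀ + ((t + 1 : ℕ) : ℤ)) - p a₀ b₀)).im) +
    (∑ s ∈ range ρ, ((starRingEnd ℂ) (p (a₀ + ((s + 1 : ℕ) : ℤ) - ρ) (b₀ + ρ) - p a₀ b₀) *
        (p (a₀ + s - ρ) (b₀ + ρ) - p a₀ b₀)).im) +
    (∑ t ∈ range ρ, ((starRingEnd ℂ) (p (a₀ + ((0 : ℕ) : ℤ) - ((t + 1 : ℕ) : ℤ))
        (b₀ + ((t + 1 : ℕ) : ℤ)) - p a₀ b₀) * (p (a₀ + ((0 : ℕ) : ℤ) - t) (b₀ + t) - p a₀ b₀)).im) := by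
  have key := rsd_shoelace_grid (fun s t => p (a₀ + s - t) (b₀ + t) - p a₀ b₀) ρ
  beta_reduce at key
  rw [← key, Finset.mul_sum]
  apply Finset.sum_le_sum
  intro s hs
  rw [Finset.mul_sum]
  apply Finset.sum_le_sum
  intro t ht
  have hsZ : (s : ℤ) < ρ := by exact_mod_cast Finset.mem_range.1 hs
  have htZ : (t : ℤ) < ρ := by exact_mod_cast Finset.mem_range.1 ht
  -- the four vertices of the cell and the increments
  set P := p (a₀ + s - t) (b₀ + t) - p a₀ b₀ with hP
  set a : ℤ := a₀ + s - t with ha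
  set b : ℤ := b₀ + t with hb
  have eQ : p (a₀ + ((s + 1 : ℕ) : ℤ) - t) (b₀ + t) - p a₀ b₀ = P + G EC[a, b] := by
    have h := hH a b (by linarith) (by linarith) (by linarith) (by linarith)
    have e : a₀ + ((s + 1 : ℕ) : ℤ) - t = a + 1 := by push_cast; ring
    rw [e, hP]; linear_combination h
  have eR : p (a₀ + ((s + 1 : ℕ) : ℤ) - ((t + 1 : ℕ) : ℤ)) (b₀ + ((t + 1 : ℕ) : ℤ)) - p a₀ b₀ =
      P + triZeta * G EB[a, b] := by
    have h := hV a b (by linarith) (by linarith) (by linarith) (by linarith)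
    have e1 : a₀ + ((s + 1 : ℕ) : ℤ) - ((t + 1 : ℕ) : ℤ) = a := by push_cast; ring
    have e2 : b₀ + ((t + 1 : ℕ) : ℤ) = b + 1 := by push_cast; ring
    rw [e1, e2, hP]; linear_combination h
  have eS : p (a₀ + s - ((t + 1 : ℕ) : ℤ)) (b₀ + ((t + 1 : ℕ) : ℤ)) - p a₀ b₀ =
      P + (triZeta - 1) * G EA[a - 1, b] := by
    have h := hD (a - 1) b (by linarith) (by linarith) (by linarith) (by linarith)
    have e1 : a₀ + (s : ℤ) - ((t + 1 : ℕ) : ℤ) = a - 1 := by push_cast; ring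
    have e2 : b₀ + ((t + 1 : ℕ) : ℤ) = b + 1 := by push_cast; ring
    have e3 : a - 1 + 1 = a := by ring
    rw [e3] at h
    rw [e1, e2, hP]; linear_combination h
  rw [eQ, eR, eS, ← rsd_cell_shoelace]
  have s1 : P + G EC[a, b] - P = G EC[a, b] := by ring
  have s2 : P + triZeta * G EB[a, b] - P = triZeta * G EB[a, b] := by ring
  have s3 : P + (triZeta - 1) * G EA[a - 1, b] - P = (triZeta - 1) * G EA[a - 1, b] := by ring
  rw [s1, s2, s3, mul_add]
  -- closures of the up triangle at `(a,b)` and of the down triangle at `(a-1,b)`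
  have hup : G EC[a, b] + (triZeta - 1) * G EA[a, b] - triZeta * G EB[a, b] = 0 := by
    have h1 := hH a b (by linarith) (by linarith) (by linarith) (by linarith)
    have h2 := hD a b (by linarith) (by linarith) (by linarith) (by linarith)
    have h3 := hV a b (by linarith) (by linarith) (by linarith) (by linarith)
    linear_combination -h1 - h2 + h3
  have hdown : G EC[a - 1, b + 1] + (triZeta - 1) * G EA[a - 1, b] - triZeta * G EB[a, b] = 0 := by
    have h1 := hH (a - 1) (b + 1) (by linarith) (by linarith) (by linarith) (by linarith)
    have h2 := hD (a - 1) b (by linarith) (by linarith) (by linarith) (by linarith)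
    have h3 := hV a b (by linarith) (by linarith) (by linarith) (by linarith)
    have e3 : a - 1 + 1 = a := by ring
    rw [e3] at h1 h2
    linear_combination -h1 - h2 + h3
  have A1 := rsd_up_area_ge hε hε1 hup
    (hPA a b (by linarith) (by linarith) (by linarith) (by linarith))
    (hPB a b (by linarith) (by linarith) (by linarith) (by linarith))
    (hPC a b (by linarith) (by linarith) (by linarith) (by linarith))
  have A2 := rsd_down_area_ge hε hε1 hdown
    (hPA (a - 1) b (by linarith) (by linarith) (by linarith) (by linarith))
    (hPB a b (by linarith) (by linarith) (by linarith) (by linarith))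
    (hPC (a - 1) (b + 1) (by linarith) (by linarith) (by linarith) (by linarith))
  have e4 : a₀ + (s : ℤ) - t - 1 = a - 1 := by rw [ha]
  have e5 : b₀ + (t : ℤ) + 1 = b + 1 := by rw [hb]
  rw [e4, e5]
  linarith

end Summit.CriticalPhenomena.SAWScalingLimit.Theorems
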